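import Literature.Topology.FourManifolds.GluingUniqueness
import Literature.Topology.FourManifolds.GluingConstruction
import HarnessLib

/-!
# Descending maps to a glued space

The universal property of the glued space `A ∪_glue B` (`SmoothGlueData.Glued`,
`GluingConstruction.lean`): a pair of maps `F_A : A → Z`, `F_B : B → Z` compatible with the
identification `a ∼ glue a` descends to `A ∪_glue B → Z`, and the descended map is smooth at
`inl a` (resp. `inr b`) as soon as `F_A` (resp. `F_B`) is smooth at `a` (resp. `b`) — the local
form of the tree's `IsOpenGluing.contMDiff_of_comp_eq` (`contMDiffAt_of_comp_isImmersionAt`,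
Kosinski VI.1). Needed to write maps *out of* the glued mapping tori and surgered manifolds of the
shear model that are smooth only off a closed set (the branched regluing twists in the model
computation of R. Gompf, *More Cappell–Shaneson spheres are standard*, Algebr. Geom. Topol. 10
(2010), Lemma 2.2).

* `Literature.Topology.FourManifolds.SmoothGlueData.desc`, `desc_inl`, `desc_inr`,
  `contMDiffAt_desc_inl`, `contMDiffAt_desc_inr`, `contMDiff_desc`.

Everything is proved; no named facts.

## References

* A. Kosinski, *Differential Manifolds*, Academic Press (1993), Ch. VI §1. [Kosinski1993]
* R. E. Gompf, *More Cappell–Shaneson spheres are standard*, Algebr. Geom. Topol. 10 (2010)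
  1665–1681, Lemma 2.2. [GompfAGT2010]
-/

noncomputable section

open scoped Manifold ContDiff Topology
open Set Function

namespace Literature.Topology.FourManifolds

namespace SmoothGlueData

universe uA uB

variable {E_A H_A : Type*} [NormedAddCommGroup E_A] [NormedSpace ℝ E_A] [TopologicalSpace H_A]
  {E_B H_B : Type*} [NormedAddCommGroup E_B] [NormedSpace ℝ E_B] [TopologicalSpace H_B]
  {I_A : ModelWithCorners ℝ E_A H_A} {I_B : ModelWithCorners ℝ E_B H_B}
  {A : Type uA} [TopologicalSpace A] [ChartedSpace H_A A]
  {B : Type uB} [TopologicalSpace B] [ChartedSpace H_B B]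
  {E_P : Type*} [NormedAddCommGroup E_P] [NormedSpace ℝ E_P]
  (d : SmoothGlueData I_A I_B A B E_P) {Z : Type*}

/-- **Descending a compatible pair of maps to the glued space.** [cite: Kosinski1993, Ch. VI §1] -/
def desc (FA : A → Z) (FB : B → Z) (h : ∀ a, a ∈ d.glue.source → FA a = FB (d.glue a)) : d.Glued → Z :=
  Quotient.lift (Sum.elim FA FB) (by
    rintro (a | b) (a' | b') hr
    · change a = a' at hr; subst hr; rfl
    · change a ∈ d.glue.source ∧ d.glue a = b' at hr
      show FA a = FB b'
      rw [h a hr.1, hr.2]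
    · change a' ∈ d.glue.source ∧ d.glue a' = b at hr
      show FB b = FA a'
      rw [h a' hr.1, hr.2]
    · change b = b' at hr; subst hr; rfl)

variable {FA : A → Z} {FB : B → Z} (h : ∀ a, a ∈ d.glue.source → FA a = FB (d.glue a))

/-- The descended map on the first piece. [folklore] -/
@[simp] theorem desc_inl (a : A) : d.desc FA FB h (d.inl a) = FA a := rfl

/-- The descended map on the second piece. [folklore] -/
@[simp] theorem desc_inr (b : B) : d.desc FA FB h (d.inr b) = FB b := rfl

section Smooth

variable [I_A.Boundaryless] [I_B.Boundaryless] [IsManifold I_A ∞ A] [IsManifold I_B ∞ B]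
  {E_Z H_Z : Type*} [NormedAddCommGroup E_Z] [NormedSpace ℝ E_Z] [TopologicalSpace H_Z]
  {I_Z : ModelWithCorners ℝ E_Z H_Z} [TopologicalSpace Z] [ChartedSpace H_Z Z]

/-- **Smoothness of the descended map at a point of the first piece** from smoothness of `F_A`
there (the first piece is an open smooth embedding). [cite: Kosinski1993, Ch. VI §1, proof of Thm (1.1)] -/
theorem contMDiffAt_desc_inl [IsManifold I_Z ∞ Z] {a : A} (ha : ContMDiffAt I_A I_Z ∞ FA a) :
    ContMDiffAt 𝓘(ℝ, E_P) I_Z ∞ (d.desc FA FB h) (d.inl a) :=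
  contMDiffAt_of_comp_isImmersionAt (d.isSmoothEmbedding_inl.isImmersion.isImmersionAt a)
    d.isOpenMap_inl ha (d.desc_inl h)

/-- **Smoothness of the descended map at a point of the second piece.** [cite: Kosinski1993, Ch. VI §1, proof of Thm (1.1)] -/
theorem contMDiffAt_desc_inr [IsManifold I_Z ∞ Z] {b : B} (hb : ContMDiffAt I_B I_Z ∞ FB b) :
    ContMDiffAt 𝓘(ℝ, E_P) I_Z ∞ (d.desc FA FB h) (d.inr b) :=
  contMDiffAt_of_comp_isImmersionAt (d.isSmoothEmbedding_inr.isImmersion.isImmersionAt b)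
    d.isOpenMap_inr hb (d.desc_inr h)

/-- Global smoothness of the descended map from smoothness of both pieces. [folklore] -/
theorem contMDiff_desc [IsManifold I_Z ∞ Z] (hA : ContMDiff I_A I_Z ∞ FA) (hB : ContMDiff I_B I_Z ∞ FB) :
    ContMDiff 𝓘(ℝ, E_P) I_Z ∞ (d.desc FA FB h) := by
  intro p
  rcases d.exists_inl_or_inr p with ⟨a, rfl⟩ | ⟨b, rfl⟩
  · exact d.contMDiffAt_desc_inl h (hA a)
  · exact d.contMDiffAt_desc_inr h (hB b)

end Smooth

/-- **Values determine the descended map**: any `G` with `G ∘ inl = F_A`, `G ∘ inr = F_B` is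
`desc`. [folklore] -/
theorem eq_desc {G : d.Glued → Z} (hGA : ∀ a, G (d.inl a) = FA a) (hGB : ∀ b, G (d.inr b) = FB b) :
    G = d.desc FA FB h := by
  funext p
  rcases d.exists_inl_or_inr p with ⟨a, rfl⟩ | ⟨b, rfl⟩
  · rw [hGA, desc_inl]
  · rw [hGB, desc_inr]

end SmoothGlueData

end Literature.Topology.FourManifolds
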